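import Literature.NumberTheory.LFunctions.EisensteinGrossencharacterSums
import Literature.NumberTheory.LFunctions.LSeriesContinuationOfPartialSums
import Literature.NumberTheory.LFunctions.LogDerivPackage
import Literature.NumberTheory.LFunctions.TwistedZFRLOne
import HarnessLib

/-!
# The `L`-functions `L(s, ν_{D,r,m})` of the cubic Grössencharacters of `ℚ(ζ₃)`: continuation to
# `σ > 3/4`, the zero-free-region datum WITHOUT pole, and `|L(1, ν)| ≥ c₀/(log Q + log 4)³`

Topic `NumberTheory/LFunctions`; namespace `Literature.NumberTheory.LFunctions.EisensteinGrossen`;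
sequel to `EisensteinGrossencharacterSums` (the characters `grossenNu D r m` and their partial sums
`O(N(9D) m N^{3/4})`). Definitions with bodies (`C0`, `grossenL`, `condQ`) and theorems; no named
fact (D-0026). Filed in support of the named fact `murty_petersson_newform_lower_bound` (the `j = 0`
CM family: `L(Sym² f_E, s) = L(s, χ₋₃) L(s, ν_E) E(s)` with `ν_E = ν_{Δ_E,1,2}`, so the lower bound
for `L(Sym² f_E, 1)` reduces to the one proved here). Model: `Sieve/HeathBrownCubicGrossenLFunction`
and `…GrossenZFR` (the same assembly for Heath-Brown's characters of `ℚ(∛2)`), here simpler: no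
norm twist, and NO POLE CASE — the companion `ν² = ν_{D,2r,2m}` has frequency `2m ≠ 0` and is again
entire, so no exceptional (Siegel) zero can occur for this family and all constants are effective.

* `grossenL D r m := contF (twistCount K3 ν)` (`LSeriesContinuationOfPartialSums`, `θ = 3/4`,
  `C₀ = 4 C_w N(9D) m`): `differentiableOn_grossenL` (`σ > 3/4`), `grossenL_eq_LSeries` (`σ > 1`),
  `norm_grossenL_le` (`‖L‖ ≤ (C₀/δ)(|t|+4)` on `3/4 + δ ≤ σ ≤ 3`), `grossenL_ne_zero`,
  `exists_grossenL_lower`, `logDeriv_grossenL` (from `TwistedDedekindCoefficients`);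
* `condQ D m = C₀(D, 2m) = 8 C_w N(9D) m` (`one_le_condQ`, `C0_le_condQ`, `norm_grossenL_le_condQ`);
* **`exists_twistedZFRData`** — absolute `c₁, K₀, C₂` with
  `TwistedZFRData (1/8) 1 8 c₁ K₀ C₂ false (condQ D m) Λ_{K3} Λ_ν Λ_{ν²} (grossenL D r m)` for all
  `D ≠ 0`, `r`, `m ≥ 1` (`three_four_one` with `ν₂ = ν_{D,2r,2m}`, companion bound from
  `LogDerivPackage.re_LSeries_le_of_majorant` applied to `L(s, ν²)` with the same conductor);
* **`exists_norm_grossenL_one_ge`** — an absolute `c₀ > 0` with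
  `c₀/(log(condQ D m) + log 4)³ ≤ ‖grossenL D r m 1‖` (`TwistedZFRLOne.exists_const_norm_one_ge`):
  the lower bound at `1` is polynomial-logarithmic in `N(D)` and `m`.

## References

* E. Hecke, *Eine neue Art von Zetafunktionen …* II, Math. Z. 6 (1920), §6. [cite: HeckeMathZ1920, §6]
* H. L. Montgomery, R. C. Vaughan, *Multiplicative Number Theory I*, CUP 2007, §11.1 Theorem 11.3,
  Lemma 11.1. [cite: MontgomeryVaughan2007, §11.1 Theorem 11.3]

## Mathlib / tree search

Tree: `EisensteinGrossencharacterSums` (`grossenNu`, `norm_grossenNu_le`, `grossenNu_sq`,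
`norm_sum_twistCount_grossenNu_le_rpow`, `Cw`, `Cw_pos`), `LSeriesContinuationOfPartialSums`
(`contF`, `differentiableOn_contF`, `contF_eq_LSeries`, `norm_contF_le_of_le`),
`TwistedDedekindCoefficients` (`LSeriesSummable_twistCount`, `LSeries_twistCount_ne_zero`,
`logDeriv_LSeries_twistCount`, `exists_norm_LSeries_twistCount_ge`, `three_four_one`,
`exists_re_LSeries_vonMangoldtNorm_le`, `norm_twistVonMangoldt_le`, `vonMangoldtNorm_nonneg`,
`LSeriesSummable_vonMangoldtNorm`), `LogDerivPackage.re_LSeries_le_of_majorant`,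
`TwistedZeroFreeRegion` (`TwistedZFRData`, `TwistedZFR.ell_pos`), `TwistedZFRLOne`
(`TwistedZFRData.exists_const_norm_one_ge`). No Hecke `L`-function of `ℚ(√−3)` existed in the tree
(`lean search 'grossenL|EisensteinGrossen'`).
-/

noncomputable section

open NumberField Complex Finset Set
open scoped ComplexConjugate Topology

namespace Literature.NumberTheory.LFunctions.EisensteinGrossen

open Literature.NumberTheory.NumberFields Literature.NumberTheory.NumberFields.K3
open LFunctions LFunctions.NumberField LFunctions.PartialSumContinuation Filter Topology

variable (D : 𝓞 K3) (r m : ℕ)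

/-! ### The partial-sum constant and the continued `L`-function -/

/-- The partial-sum constant `C₀(D, m) = 4 C_w N(9D) m`. [folklore] -/
def C0 : ℝ := 4 * Cw * Ideal.absNorm (Ideal.span {(9 * D : 𝓞 K3)}) * m

/-- `0 ≤ C₀`. [folklore] -/
theorem C0_nonneg : 0 ≤ C0 D m := by
  unfold C0; have := Cw_pos; positivity

/-- `C₀(D, m) ≤ C₀(D, m')` for `m ≤ m'`. [folklore] -/
theorem C0_mono {m m' : ℕ} (h : m ≤ m') : C0 D m ≤ C0 D m' := by
  unfold C0
  have := Cw_pos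
  gcongr

/-- The partial-sum hypothesis of `LSeriesContinuationOfPartialSums` (`θ = 3/4`). [folklore] -/
theorem partialSum_hyp (hD0 : D ≠ 0) (hm : 1 ≤ m) :
    ∀ N : ℕ, 1 ≤ N → ‖∑ k ∈ Icc 1 N, twistCount K3 (grossenNu D r m) k‖ ≤ C0 D m * (N : ℝ) ^ (3 / 4 : ℝ) :=
  fun _ hN ↦ norm_sum_twistCount_grossenNu_le_rpow r m hD0 hm hN

/-- **The continued `L`-function** `L(s, ν_{D,r,m}) := contF (a_ν) s` (`= Σ ν(I)N(I)^{-s}` for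
`σ > 1`, holomorphic on `σ > 3/4`). [cite: HeckeMathZ1920, §6] -/
def grossenL (s : ℂ) : ℂ := contF (twistCount K3 (grossenNu D r m)) s

/-- `0 ≤ 3/4`. [folklore] -/
theorem three_quarters_nonneg : (0 : ℝ) ≤ 3 / 4 := by norm_num

/-- **`L(s, ν)` is holomorphic on `σ > 3/4`.** [cite: HeckeMathZ1920, §6] -/
theorem differentiableOn_grossenL (hD0 : D ≠ 0) (hm : 1 ≤ m) :
    DifferentiableOn ℂ (grossenL D r m) {s : ℂ | 3 / 4 < s.re} :=
  differentiableOn_contF three_quarters_nonneg (partialSum_hyp D r m hD0 hm)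

/-- **`L(s, ν) = Σ ν(I) N(I)^{−s}` for `σ > 1`.** [cite: HeckeMathZ1920, §6] -/
theorem grossenL_eq_LSeries (hD0 : D ≠ 0) (hm : 1 ≤ m) {s : ℂ} (hs : 1 < s.re) :
    grossenL D r m s = LSeries (twistCount K3 (grossenNu D r m)) s :=
  contF_eq_LSeries three_quarters_nonneg (partialSum_hyp D r m hD0 hm) (by norm_num) hs
    (LSeriesSummable_twistCount (K := K3) (norm_grossenNu_le D r m) hs)

/-- **Growth in the strip** `3/4 + δ ≤ σ ≤ 3`: `‖L(s, ν)‖ ≤ (C₀/δ)(|t| + 4)`. [cite: HeckeMathZ1920, §6] -/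
theorem norm_grossenL_le (hD0 : D ≠ 0) (hm : 1 ≤ m) {δ : ℝ} (hδ : 0 < δ) {s : ℂ}
    (hs : 3 / 4 + δ ≤ s.re) (hs3 : s.re ≤ 3) :
    ‖grossenL D r m s‖ ≤ C0 D m / δ * (|s.im| + 4) :=
  norm_contF_le_of_le three_quarters_nonneg (partialSum_hyp D r m hD0 hm) hδ hs hs3

/-- **`L(s, ν) ≠ 0` for `σ > 1`.** [folklore] -/
theorem grossenL_ne_zero (hD0 : D ≠ 0) (hm : 1 ≤ m) {s : ℂ} (hs : 1 < s.re) : grossenL D r m s ≠ 0 := by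
  rw [grossenL_eq_LSeries D r m hD0 hm hs]
  exact LSeries_twistCount_ne_zero (norm_grossenNu_le D r m) hs

/-- **The lower bound** `c₁(σ − 1) ≤ |L(s, ν)|` for `1 < σ ≤ 2`, `c₁ > 0` depending on `K3` only.
[cite: MontgomeryVaughan2007, Lemma 11.1] -/
theorem exists_grossenL_lower :
    ∃ c₁ : ℝ, 0 < c₁ ∧ ∀ (D : 𝓞 K3) (r m : ℕ), D ≠ 0 → 1 ≤ m → ∀ s : ℂ, 1 < s.re → s.re ≤ 2 →
      c₁ * (s.re - 1) ≤ ‖grossenL D r m s‖ := by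
  obtain ⟨c₁, hc₁, h⟩ := exists_norm_LSeries_twistCount_ge (K := K3)
  refine ⟨c₁, hc₁, fun D r m hD0 hm s hs hs2 ↦ ?_⟩
  rw [grossenL_eq_LSeries D r m hD0 hm hs]
  exact h _ (norm_grossenNu_le D r m) s hs hs2

/-- **`L'/L(s, ν) = −Σ Λ_ν(n) n^{−s}` for `σ > 1`.** [folklore] -/
theorem logDeriv_grossenL (hD0 : D ≠ 0) (hm : 1 ≤ m) {s : ℂ} (hs : 1 < s.re) :
    deriv (grossenL D r m) s / grossenL D r m s = -LSeries (twistVonMangoldt K3 (grossenNu D r m)) s := by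
  have hev : grossenL D r m =ᶠ[𝓝 s] LSeries (twistCount K3 (grossenNu D r m)) := by
    have ho : IsOpen {z : ℂ | 1 < z.re} := isOpen_lt continuous_const Complex.continuous_re
    filter_upwards [ho.mem_nhds hs] with z hz
    exact grossenL_eq_LSeries D r m hD0 hm hz
  rw [hev.deriv_eq, grossenL_eq_LSeries D r m hD0 hm hs]
  exact logDeriv_LSeries_twistCount (norm_grossenNu_le D r m) hs

/-! ### The conductor and the zero-free-region datum (no pole: the companion has frequency `2m ≠ 0`) -/

/-- **The conductor-type size** `Q(D, m) = C₀(D, 2m) = 8 C_w N(9D) m`. [folklore] -/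
def condQ : ℝ := C0 D (2 * m)

/-- `1 ≤ C_w`. [folklore] -/
theorem one_le_Cw : 1 ≤ Cw := by
  unfold Cw
  have hw := w_im_pos
  have h1 : 1 ≤ 4 * (1 + ‖w‖) / w.im + 1 := by
    have : 0 ≤ 4 * (1 + ‖w‖) / w.im := by positivity
    linarith
  have h2 : 1 ≤ 4 * (1 + ‖w‖) + 1 := by have := norm_nonneg w; linarith
  nlinarith

/-- `Q ≥ 1` (`D ≠ 0`, `m ≥ 1`). [folklore] -/
theorem one_le_condQ (hD0 : D ≠ 0) (hm : 1 ≤ m) : 1 ≤ condQ D m := by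
  unfold condQ C0
  have h9D : (9 * D : 𝓞 K3) ≠ 0 := by
    refine mul_ne_zero ?_ hD0
    have : ((9 : ℕ) : 𝓞 K3) ≠ 0 := Nat.cast_ne_zero.mpr (by norm_num)
    exact_mod_cast this
  have hN : (1 : ℝ) ≤ Ideal.absNorm (Ideal.span {(9 * D : 𝓞 K3)}) := by
    have : 1 ≤ Ideal.absNorm (Ideal.span {(9 * D : 𝓞 K3)}) := by
      rw [Nat.one_le_iff_ne_zero, Ne, Ideal.absNorm_eq_zero_iff, Ideal.span_singleton_eq_bot]
      exact h9D
    exact_mod_cast this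
  have hm' : (1 : ℝ) ≤ ((2 * m : ℕ) : ℝ) := by exact_mod_cast (by omega : 1 ≤ 2 * m)
  have hC := one_le_Cw
  calc (1 : ℝ) ≤ 4 * 1 * 1 * 1 := by norm_num
    _ ≤ 4 * Cw * Ideal.absNorm (Ideal.span {(9 * D : 𝓞 K3)}) * ((2 * m : ℕ) : ℝ) := by
        gcongr

/-- `C₀(D, m) ≤ Q(D, m)`. [folklore] -/
theorem C0_le_condQ : C0 D m ≤ condQ D m := C0_mono D (by omega)

/-- **Growth with conductor**: `‖L(s, ν_{D,r,m'})‖ ≤ 8 Q(D,m) (|t| + 4)` for `7/8 < σ ≤ 3`, for both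
`m' = m` and the companion `m' = 2m`. [cite: HeckeMathZ1920, §6] -/
theorem norm_grossenL_le_condQ (hD0 : D ≠ 0) {m' : ℕ} (hm' : 1 ≤ m') (hle : C0 D m' ≤ condQ D m)
    (r' : ℕ) {s : ℂ} (hs : 1 - 1 / 8 < s.re) (hs3 : s.re ≤ 3) :
    ‖grossenL D r' m' s‖ ≤ 8 * condQ D m ^ (1 : ℝ) * (|s.im| + 4) ^ (1 : ℝ) := by
  rw [Real.rpow_one, Real.rpow_one]
  have h := norm_grossenL_le D r' m' hD0 hm' (δ := 1 / 8) (by norm_num) (s := s) (by linarith) hs3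
  refine h.trans ?_
  have ht : 0 ≤ |s.im| + 4 := by positivity
  have : C0 D m' / (1 / 8) = 8 * C0 D m' := by ring
  rw [this]
  gcongr

/-- **The zero-free-region datum for `L(s, ν_{D,r,m})`, without pole.** Absolute constants
`c₁, K₀, C₂` (depending on `K3` only) such that for all `D ≠ 0`, `r`, `m ≥ 1` the hypotheses
`TwistedZFRData (1/8) 1 8 c₁ K₀ C₂ false Q(D,m) Λ_K Λ_ν Λ_{ν²} L(·,ν)` hold, with companion
`ν² = ν_{D,2r,2m}` (again of non-zero frequency, hence entire: no exceptional-zero case arises for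
these characters). [cite: MontgomeryVaughan2007, §11.1 Theorem 11.3] -/
theorem exists_twistedZFRData :
    ∃ c₁ K₀ C₂ : ℝ, 0 < c₁ ∧ 0 ≤ K₀ ∧ 0 ≤ C₂ ∧
      ∀ (D : 𝓞 K3) (r m : ℕ), D ≠ 0 → 1 ≤ m →
        TwistedZFRData (1 / 8) 1 8 c₁ K₀ C₂ false (condQ D m)
          (vonMangoldtNorm K3) (twistVonMangoldt K3 (grossenNu D r m))
          (twistVonMangoldt K3 (grossenNu D (2 * r) (2 * m))) (grossenL D r m) := by
  classical
  obtain ⟨c₁, hc₁, hlower⟩ := exists_grossenL_lower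
  obtain ⟨K₀, hK₀, hK⟩ := exists_re_LSeries_vonMangoldtNorm_le (K := K3)
  -- the package constant `E(1/8, 1, 8, c₁)` and `C₂`
  set E : ℝ := 8 * (2 * (1 : ℝ) + |Real.log ((8 : ℝ) / (c₁ * ((1 / 8 : ℝ) / 32)))| + 1) / ((1 / 8 : ℝ) / 4)
    with hE
  have hE0 : 0 ≤ E := by rw [hE]; positivity
  set C₂ : ℝ := E + 32 / (3 * (1 / 8 : ℝ)) + K₀ with hC₂
  have hC₂0 : 0 ≤ C₂ := by rw [hC₂]; positivity
  refine ⟨c₁, K₀, C₂, hc₁, hK₀, hC₂0, fun D r m hD0 hm ↦ ?_⟩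
  set ν := grossenNu D r m with hνdef
  set ν'' := grossenNu D (2 * r) (2 * m) with hν''def
  have hν1 : ∀ I, ‖ν I‖ ≤ 1 := norm_grossenNu_le D r m
  have hν''1 : ∀ I, ‖ν'' I‖ ≤ 1 := norm_grossenNu_le D (2 * r) (2 * m)
  have hQ1 : 1 ≤ condQ D m := one_le_condQ D m hD0 hm
  have hm2 : 1 ≤ 2 * m := by omega
  have hdiff : DifferentiableOn ℂ (grossenL D r m) {s : ℂ | 1 - 1 / 8 < s.re} :=
    (differentiableOn_grossenL D r m hD0 hm).mono fun s hs ↦ by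
      simp only [Set.mem_setOf_eq] at hs ⊢; linarith
  -- the growth package of the companion `L(s, ν'')` with the SAME conductor
  have hpack : LogDerivPackage (1 / 8) 1 8 c₁ (condQ D m) (twistVonMangoldt K3 ν'')
      (grossenL D (2 * r) (2 * m)) :=
    { eta_pos := by norm_num
      eta_le_one := by norm_num
      A_nonneg := zero_le_one
      Cg_pos := by norm_num
      c₁_pos := hc₁
      one_le_Q := hQ1
      differentiableOn := (differentiableOn_grossenL D (2 * r) (2 * m) hD0 hm2).mono fun s hs ↦ by
        simp only [Set.mem_setOf_eq] at hs ⊢; linarith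
      ne_zero := fun s hs ↦ grossenL_ne_zero D (2 * r) (2 * m) hD0 hm2 hs
      logDeriv_eq := fun s hs ↦ logDeriv_grossenL D (2 * r) (2 * m) hD0 hm2 hs
      growth := fun s hs hs3 ↦ norm_grossenL_le_condQ D m hD0 hm2 le_rfl (2 * r) hs hs3
      lower := fun s hs hs2 ↦ hlower D (2 * r) (2 * m) hD0 hm2 s hs hs2 }
  have hmaj := hpack.re_LSeries_le_of_majorant hK₀ (norm_twistVonMangoldt_le hν''1)
    (fun s hs ↦ LSeriesSummable_vonMangoldtNorm (K := K3) hs) hK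
  exact {
    eta_pos := by norm_num
    eta_le_one := by norm_num
    A_nonneg := zero_le_one
    Cg_pos := by norm_num
    c₁_pos := hc₁
    K₀_nonneg := hK₀
    C₂_nonneg := hC₂0
    one_le_Q := hQ1
    nonneg := vonMangoldtNorm_nonneg
    summable := fun s hs ↦ LSeriesSummable_vonMangoldtNorm (K := K3) hs
    re_LSeries₀_le := hK
    norm_le₁ := norm_twistVonMangoldt_le hν1
    norm_le₂ := norm_twistVonMangoldt_le hν''1
    three_four_one := fun σ hσ t ↦
      three_four_one hν1 (ν₂ := ν'') (fun I ↦ (grossenNu_sq D r m I).symm) hσ t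
    differentiableOn := hdiff
    ne_zero := fun s hs ↦ grossenL_ne_zero D r m hD0 hm hs
    logDeriv_eq := fun s hs ↦ logDeriv_grossenL D r m hD0 hm hs
    growth := fun s hs hs3 ↦ norm_grossenL_le_condQ D m hD0 hm (C0_le_condQ D m) r hs hs3
    lower := fun s hs hs2 ↦ hlower D r m hD0 hm s hs hs2
    re_LSeries₂_le := fun s hs hs2 ↦ by
      simp only [Bool.false_eq_true, ite_false, zero_add]
      refine (hmaj s hs hs2).trans ?_
      have hℒ : 0 ≤ Real.log (condQ D m) + Real.log (|s.im| + 4) := (TwistedZFR.ell_pos hQ1 s.im).le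
      refine mul_le_mul_of_nonneg_right ?_ hℒ
      rw [hC₂, hE]
    reflect := fun h ↦ absurd h Bool.false_ne_true }

/-- **The lower bound at `s = 1`**: an absolute `c₀ > 0` with
`c₀ / (log Q(D,m) + log 4)³ ≤ |L(1, ν_{D,r,m})|` for all `D ≠ 0`, `r`, `m ≥ 1`, where
`Q(D, m) = 8 C_w N(9D) m` — polynomial in `N(D)` and `m` (`TwistedZFRLOne.exists_const_norm_one_ge`
applied to the datum above). [cite: MontgomeryVaughan2007, §11.1 Theorem 11.3] -/
theorem exists_norm_grossenL_one_ge :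
    ∃ c₀ : ℝ, 0 < c₀ ∧ ∀ (D : 𝓞 K3) (r m : ℕ), D ≠ 0 → 1 ≤ m →
      c₀ / (Real.log (condQ D m) + Real.log 4) ^ 3 ≤ ‖grossenL D r m 1‖ := by
  obtain ⟨c₁, K₀, C₂, hc₁, hK₀, hC₂, hdata⟩ := exists_twistedZFRData
  obtain ⟨c₀, hc₀, h⟩ := TwistedZFRData.exists_const_norm_one_ge (η := 1 / 8) (A := 1) (Cg := 8)
    (c₁ := c₁) (K₀ := K₀) (C₂ := C₂) (by norm_num) (by norm_num) zero_le_one hc₁ hK₀ hC₂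
  exact ⟨c₀, hc₀, fun D r m hD0 hm ↦ h _ _ _ _ _ (hdata D r m hD0 hm)⟩

end Literature.NumberTheory.LFunctions.EisensteinGrossen

end
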